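import Mathlib
import HarnessLib
import Summits.CriticalPhenomena.PercolationContinuityZ3.Theses.PercTreeValue
import Summits.CriticalPhenomena.PercolationContinuityZ3.Theorems.PercTreeValueAssembly
import Summits.CriticalPhenomena.PercolationContinuityZ3.Theorems.PercTreeValueConnectionPatternFactorisation
import Summits.CriticalPhenomena.PercolationContinuityZ3.Theorems.PercTreeValueAssemblyViaDisjointCoexistence
import Literature.Probability.Percolation.PercolationEvents
import Literature.Probability.Percolation.InfiniteClusterDensity
import Literature.Probability.Percolation.TwoPointFunction

/-!
# Strategist r1 (redirect) census sketch for crux stmt-CriticalPhenomena-7799 (`PercTreeValue.TetrahedronHarrisGap`)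

Planner `planner-cstrat-stmt-CriticalPhenomena-7799-r1-0`, 2026-08-17.  Two kinds of content:

* §1 **Strength certificate (PROVED, no `sorry`)** — the tree theorems the tribunal needs to place the crux
  relative to the conjunct `PercolationContinuityZ3` (`θ(p_c(ℤ³)) = 0`):
  `percolationContinuityZ3_of_tetrahedronHarrisGap` (crux ⇒ conjunct, by the landed items 7806 + 7802),
  `not_tetrahedronHarrisGap_of_theta_ne_zero` (a jump kills the crux), and the decomposition
  `tetrahedronHarrisGap_iff_continuity_and_residual` (crux ⟺ conjunct ∧ residual, the residual being the
  amplitude statement GIVEN continuity).  These are proposed verbatim as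
  `Theorems/PercTreeValueTetrahedronHarrisGapCertStrength.lean`.
* §2 **Typed signatures quoted in `STRATEGY-CENSUS.md` (r1 Part A)** — `def … : Prop` only, nothing is a line.

Notation: `a_r = (r,r,0)`, `b_r = (r,0,r)`, `c_r = (0,r,r)`; `A = {0 ↔ a_r}`, `B = {b_r ↔ c_r}`;
`τ_A = τ(0,a_r)`, `τ_B = τ(b_r,c_r)`; `P = P_{p_c(ℤ³)}`.
-/

noncomputable section

open MeasureTheory Filter Set
open Literature.Probability.Percolation Literature.Probability.LatticeModels
open Summit.CriticalPhenomena.PercolationContinuityZ3.Theses.PercTreeValue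

namespace Summit.CriticalPhenomena.PercolationContinuityZ3.Cruxes.TetrahedronHarrisGap.CensusR1

/-! ## §1 Strength certificate (proved) -/

/-- **The crux implies the conjunct.** `TetrahedronHarrisGap → θ(p_c(ℤ³)) = 0`: the landed assembly
`percTreeValue_assembly_proof` (item 7806: `ConnectionPatternFactorisation → TetrahedronHarrisGap → PercolationContinuityZ3`)
fed with the landed pattern-blindness theorem `connectionPatternFactorisation_proof` (item 7802).  So any proof of the
crux from inputs `X₁ ∧ … ∧ X_k` is a proof of the sub-problem from the same inputs. [folklore] -/
theorem percolationContinuityZ3_of_tetrahedronHarrisGap :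
    TetrahedronHarrisGap → _root_.PercolationContinuityZ3 := by
  intro h
  have hA := Summit.CriticalPhenomena.PercolationContinuityZ3.Theorems.percTreeValue_assembly_proof
  unfold Summit.CriticalPhenomena.PercolationContinuityZ3.Theses.PercTreeValue.Assembly at hA
  exact hA Summit.CriticalPhenomena.PercolationContinuityZ3.Theorems.connectionPatternFactorisation_proof h

/-- **A jump kills the crux.** If `θ(p_c) ≠ 0` on `ℤ³` then the uniform strict Harris inequality for the two
opposite edges of the lattice tetrahedron FAILS (asymptotic Harris EQUALITY in every jump world).  Every all-graph /
all-`p` tool (Harris, BK, Reimer, vdBK conditional inequalities, the pairing bound `H ≤ 3`, exact identities such as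
`H = Ψ + d`, the noise / total-covariance representations) is valid verbatim in a jump world, hence no argument built
from those alone proves the crux. [folklore] -/
theorem not_tetrahedronHarrisGap_of_theta_ne_zero :
    theta (zdGraph 3) (0 : Site 3) (criticalProbI 3) ≠ 0 → ¬ TetrahedronHarrisGap :=
  fun hθ h => hθ (percolationContinuityZ3_iff.mp (percolationContinuityZ3_of_tetrahedronHarrisGap h))

/-- **Crux = conjunct + residual.** `TetrahedronHarrisGap ⟺ PercolationContinuityZ3 ∧ (PercolationContinuityZ3 →
TetrahedronHarrisGap)`: the crux is the sub-problem PLUS the amplitude statement given continuity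
(`AmplitudeGivenContinuity` below), and nothing else.  The residual is NOT expected to be a theorem of `θ(p_c) = 0`
alone: in the decided high-dimensional regime (`d ≥ 11` nearest-neighbour, spread-out `d > 6`) `θ(p_c) = 0` holds while
the analogue of the crux fails (`H_r − 1 ≍ r^{6−d} → 0`, tree-graph bound + `η = 0`), see the census §N7. [folklore] -/
theorem tetrahedronHarrisGap_iff_continuity_and_residual :
    TetrahedronHarrisGap ↔
      (_root_.PercolationContinuityZ3 ∧ (_root_.PercolationContinuityZ3 → TetrahedronHarrisGap)) :=
  ⟨fun h => ⟨percolationContinuityZ3_of_tetrahedronHarrisGap h, fun _ => h⟩, fun h => h.2 h.1⟩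

/-- The residual summand, named. [this census] -/
def AmplitudeGivenContinuity : Prop := _root_.PercolationContinuityZ3 → TetrahedronHarrisGap

/-- The rank-2 sibling is summit-sufficient too (item 7803, landed `AssemblyViaDisjointCoexistence_proof`), recorded here
because §2's decomposition analysis (D9) reduces the noise line's content stub to it. [folklore] -/
theorem percolationContinuityZ3_of_tetrahedronDisjointCoexistence :
    TetrahedronDisjointCoexistence → _root_.PercolationContinuityZ3 :=
  Summit.CriticalPhenomena.PercolationContinuityZ3.Theorems.AssemblyViaDisjointCoexistence_proof

/-! ## §2 Typed census signatures (r1 Part A); `Prop`s only -/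

/-- The critical measure on `ℤ³`. -/
abbrev P : Measure (BondConfig (Site 3)) := bondPercolation (zdGraph 3) (criticalProbI 3)

/-- `A_r = {0 ↔ a_r}`. -/
abbrev evA (r : ℕ) : Set (BondConfig (Site 3)) := openConn (0 : Site 3) ![(r : ℤ), (r : ℤ), 0]
/-- `B_r = {b_r ↔ c_r}`. -/
abbrev evB (r : ℕ) : Set (BondConfig (Site 3)) := openConn (![(r : ℤ), 0, (r : ℤ)] : Site 3) ![0, (r : ℤ), (r : ℤ)]
/-- `τ_A(r)`. -/
abbrev τA (r : ℕ) : ℝ := tau 3 (criticalProbI 3) 0 ![(r : ℤ), (r : ℤ), 0]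
/-- `τ_B(r)`. -/
abbrev τB (r : ℕ) : ℝ := tau 3 (criticalProbI 3) ![(r : ℤ), 0, (r : ℤ)] ![0, (r : ℤ), (r : ℤ)]

/-- **S⁺8a `BKSaturation`** (strengthening considered and rejected): asymptotic BK EQUALITY for the two opposite edges,
`P(A □ B)/(τ_A τ_B) → 1` (`Δ_r → 0` in ideator 1's ledger `H − 1 = n − Δ`).  A reverse-BK statement with the SHARP
constant `1` — strictly harder than the rank-2 crux (any constant); true in the jump world and above six dimensions,
numerically `|Δ| ≲ 0.1` on `ℤ³`.  Not filed. -/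
def BKSaturation : Prop :=
  Tendsto (fun r : ℕ => P.real (disjointOccurrence (evA r) (evB r)) / (τA r * τB r)) atTop (nhds 1)

/-- **S⁺8b `SharedBottleneck`** (the partner of `BKSaturation`): with probability `≥ δ τ_A τ_B` both connections hold but
can NOT be realised edge-disjointly (`n_r ≥ δ`; numerically `n ≈ q₁·H ≈ 0.4–0.55`).  One configuration, up to constants —
but it is the crossed-bridge statement of the noise line (S1-class) in event form.  `BKSaturation ∧ SharedBottleneck ⇒ crux`
by `H − 1 = n − Δ`; not filed (S⁺8). -/
def SharedBottleneck : Prop :=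
  ∃ δ : ℝ, 0 < δ ∧ ∃ r₀ : ℕ, ∀ r : ℕ, r₀ ≤ r →
    δ * τA r * τB r ≤ P.real (evA r ∩ evB r ∩ (disjointOccurrence (evA r) (evB r))ᶜ)

/-- Crossed disjoint coexistence `D_× = D₂ ∪ D₃` (the two CROSSED pairings realised by distinct clusters); same law as
twice the rank-2 event `D₁` by the tetrahedral symmetry of `T_r` (ideator 1 F3). -/
def crossedCoexistence (r : ℕ) : Set (BondConfig (Site 3)) :=
  (openConn (0 : Site 3) ![(r : ℤ), 0, (r : ℤ)] ∩ openConn (![(r : ℤ), (r : ℤ), 0] : Site 3) ![0, (r : ℤ), (r : ℤ)] ∩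
      (evA r)ᶜ) ∪
    (openConn (0 : Site 3) ![0, (r : ℤ), (r : ℤ)] ∩ openConn (![(r : ℤ), (r : ℤ), 0] : Site 3) ![(r : ℤ), 0, (r : ℤ)] ∩
      (evA r)ᶜ)

/-- The co-pivotal (crossed-bridge) mass `J_r` of the noise line, verbatim. -/
def J (r : ℕ) : ℝ :=
  ∑ e ∈ armEdges (2 * r) (0 : Site 3),
    P.real {ω : BondConfig (Site 3) | IsPivotal (evA r) e ω ∧ IsPivotal (evB r) e ω}

/-- The pivotal mass `ν_r = Σ_e P(e ∈ Piv_A)` of the noise line, verbatim. -/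
def ν (r : ℕ) : ℝ :=
  ∑ e ∈ armEdges (2 * r) (0 : Site 3), P.real {ω : BondConfig (Site 3) | IsPivotal (evA r) e ω}

/-- The noise line's content stub S1 (`stub_bridgeMass`), as a `Prop`. -/
def BridgeMass : Prop :=
  ∃ c₁ : ℝ, 0 < c₁ ∧ ∃ r₀ : ℕ, ∀ r : ℕ, r₀ ≤ r → c₁ * ν r * τB r ≤ J r ∧ τA r ≤ ν r

/-- **D9 `KissingRegularityLower`**: given crossed coexistence, the two clusters kiss along `≳ ν/τ_A ≍ E[N_A | A]` edges:
`c · ν · P(D_×) ≤ τ_A · J` (recall `J = E[K_× ; D_×]/(1−p_c)`).  World-neutral-looking second-moment regularity. -/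
def KissingRegularityLower : Prop :=
  ∃ c : ℝ, 0 < c ∧ ∃ r₀ : ℕ, ∀ r : ℕ, r₀ ≤ r → c * ν r * P.real (crossedCoexistence r) ≤ τA r * J r

/-- **D9 `KissingRegularityUpper`**: conversely the conditional kissing number is `O(E[N_A | A])`:
`τ_A · J ≤ C · ν · P(D_×)`.  A conditional two-arm UPPER bound (Cerf 2015 gives only the unconditional
`P(two-arms(0,n)) ≤ n^{−12/23+o(1)}` in `d = 3`, far too weak: arXiv:1306.3105 Thm 1.1). -/
def KissingRegularityUpper : Prop :=
  ∃ C : ℝ, 0 < C ∧ ∃ r₀ : ℕ, ∀ r : ℕ, r₀ ≤ r → τA r * J r ≤ C * ν r * P.real (crossedCoexistence r)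

/-- Crossed form of the rank-2 crux (equivalent to `TetrahedronDisjointCoexistence` by the `T_d` symmetry of `T_r`). -/
def CrossedDisjointCoexistence : Prop :=
  ∃ δ : ℝ, 0 < δ ∧ ∃ r₀ : ℕ, ∀ r : ℕ, r₀ ≤ r → δ * τA r * τB r ≤ P.real (crossedCoexistence r)

/-- **D9, direction 1** (elementary real arithmetic, signature): reverse-BK ∧ lower kissing regularity ⇒ S1. -/
def BridgeMass_of_coexistence : Prop :=
  CrossedDisjointCoexistence → KissingRegularityLower → (∃ r₀ : ℕ, ∀ r : ℕ, r₀ ≤ r → τA r ≤ ν r) → BridgeMass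

/-- **D9, direction 2** (elementary real arithmetic, signature): S1 ∧ upper kissing regularity ⇒ reverse-BK (crossed
form), hence — by symmetry and `percolationContinuityZ3_of_tetrahedronDisjointCoexistence` — the conjunct.  So the noise
line's content stub is the rank-2 crux modulo ONE conditional two-arm regularity statement. -/
def coexistence_of_BridgeMass : Prop :=
  BridgeMass → KissingRegularityUpper → CrossedDisjointCoexistence

/-- **S⁺9 `DirectionalBoxBlocking`** (the weakest blocking input that is NOT provably summit-sufficient): at `p_c`, with
probability `≥ c`, the cube `B(n)` has no open LEFT–RIGHT crossing inside it.  No local-uniqueness theorem at `p_c`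
makes this false in a jump world; but directional blockings of SURFACES do not glue (census S⁺9), so no shell / cap
certificate can be built from it without RSW — the usable blocking primitive is the annulus sealing `X_B` (stmt-0846),
summit-sufficient by `CrossingTendstoOne`. -/
def DirectionalBoxBlocking : Prop :=
  ∃ c : ℝ, 0 < c ∧ ∀ n : ℕ, 1 ≤ n →
    c ≤ P.real {ω | ¬ ∃ x ∈ box 3 n, ∃ y ∈ box 3 n, x 0 = -(n : ℤ) ∧ y 0 = (n : ℤ) ∧
      ω ∈ openConnIn (↑(box 3 n) : Set (Site 3)) x y}

/-- **Wild-6 `ArmedNonGluing`** = uniform STRICT BK for two arms: `τ(0,a_r) ≤ (1 − c) · π(⌊r/4⌋)²`, i.e. given that `0`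
and `a_r` are both armed to distance `r/4` they still fail to be connected with conditional probability `≥ c`.
The mirror image of the crux (strict Harris ↔ strict BK).  Summit-sufficient by two lines (jump world: `τ → θ²`,
`π² → θ²`), and implied by `OneArmDoublingDecay`; recorded to show that the "strict-BK side" of the problem is a
one-arm DECAY-RATE statement in disguise (census §Strengthen). -/
def ArmedNonGluing : Prop :=
  ∃ c : ℝ, 0 < c ∧ ∃ r₀ : ℕ, ∀ r : ℕ, r₀ ≤ r → τA r ≤ (1 - c) * (P.real (siteToBoundary 3 (r / 4))) ^ 2

/-- `π(2n) ≤ (1−c) π(n)` uniformly: polynomial one-arm decay; trivially summit-sufficient (`π(n) ↓ θ(p_c)`), implied by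
`X_B` (seal the annulus independently of the inner arm). -/
def OneArmDoublingDecay : Prop :=
  ∃ c : ℝ, 0 < c ∧ ∀ n : ℕ, 1 ≤ n → P.real (siteToBoundary 3 (2 * n)) ≤ (1 - c) * P.real (siteToBoundary 3 n)

/-- Strength signature of `ArmedNonGluing` (provable now: in a jump world `P(0 armed to s, 0 ∉ C_∞) = π(s) − θ → 0`
while `τ ≥ θ²`, so `π(s)² − τ ≤ 2(π(s) − θ) + (θ² − τ)⁺ → 0 = o(π(s)²)`).  Not landed this seat. -/
def ArmedNonGluing_strength : Prop := ArmedNonGluing → _root_.PercolationContinuityZ3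

end Summit.CriticalPhenomena.PercolationContinuityZ3.Cruxes.TetrahedronHarrisGap.CensusR1

end
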